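import Mathlib.GroupTheory.FreeGroup.Basic
import Literature.IUT.HodgeTheaters.ProfiniteCompletionQuotients
import Literature.GroupTheory.CombinatorialGroupTheory.FreeGroupSubgroupSeparable
import HarnessLib

/-!
# [IUTchI] Corollary 2.3 (ii), (v): the two "elementary observations" of the printed proof

Mochizuki, *Inter-universal Teichmüller theory I*, kurims manuscript (May 2020), §2, Corollary 2.3
"Subgroups of Tempered Fundamental Groups Associated to Sub-semi-graphs", (ii) p. 47 and (v) p. 48,
with the proof on pp. 48–50 ([IUTchI] Cor 2.3 pp.47-50) [claim: Mochizuki2012, status: disputed].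
Nodes `IUTchI:Cor2.3(ii)`, `IUTchI:Cor2.3(v)`; typed statements
`StableCurveTemperedData.Cor23ii` / `Cor23v` (seat abc-iut-L5-t1) are predicates over the tempered
interface and are NOT touched here (AFTER-MERGE on the tempered fundamental groups of L3).

The printed proof REDUCES both items ("it follows immediately from the definitions of the various
tempered fundamental groups involved that … it suffices to verify …") to two statements about a
discrete group sitting densely in a completion, which are what this file proves:

* (ii), p. 48: *"If `G ↠ F` is a surjection of finitely generated free discrete groups, which induces
  a surjection `Ĝ ↠ F̂` between the respective … completions …, then `H := Ker(G ↠ F)` is dense in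
  `Ĥ := Ker(Ĝ ↠ F̂)`.  Indeed, let `ι : F ↪ G` be a section of the given surjection `G ↠ F` [which
  exists since `F` is free] …"* — `closure_image_ker_eq_ker_of_section` (any group surjection with a
  section; abstract core `ker_subset_closure_of_section`: the continuous retraction
  `x ↦ x · ŝ(π̂ x)⁻¹` onto the kernel), and `closure_image_ker_eq_ker_of_surjective_freeGroup` (free
  target ⇒ a section exists, `FreeGroup.lift`);
* (v), pp. 49–50: *"for any finitely generated subgroup `F ⊆ G` … `F̂ ∩ G = F`.  But … by [SemiAnbd],
  Corollary 1.6, (ii), … we may assume without loss of generality that the inclusion `F ⊆ G` admits a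
  splitting `G ↠ F` …, in which case the desired equality `F̂ ∩ G = F` follows immediately"* —
  the SPLIT case for ANY group and any retract (`range_inter_closure_image_of_retract`; abstract core
  `closure_inter_eq_of_continuous_retraction`: a continuous idempotent fixes the closure of its fixed
  set), and the finitely-generated case for free groups `F(α)` OUTRIGHT
  (`toCompletion_mem_closure_image_iff_of_fg`, `range_inter_closure_image_of_fg`) from the tree's
  M. Hall / separability theorem `exists_normal_finiteIndex_not_mem_sup`
  (`Literature/GroupTheory/CombinatorialGroupTheory/FreeGroupSubgroupSeparable.lean`) and the
  component description of closures in `F̂` (`ProfiniteCompletion.val_mem_map_of_mem_closure`,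
  seat abc-iut-L5-t17).

Completions here are Mathlib's PROFINITE completions (`profiniteCompletion`, `toCompletion` of
`DiscreteProfiniteConjugates.lean`), i.e. the case `Σ̂ = Primes` of the text; pro-`Σ̂` completions are
not in the tree, and the two abstract cores are stated for arbitrary topological groups so as to
apply to them verbatim once built.  No new definitions; plain group theory/topology taking no side on
[IUTchIII] Cor. 3.12; typed ≠ discharged for the tempered statements themselves.
-/

namespace Literature.IUT.HodgeTheaters.ProfiniteCompletion

open CategoryTheory ProfiniteGrp ProfiniteGrp.ProfiniteCompletion Topology
open Literature.GroupTheory.CombinatorialGroupTheory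

universe u

/-! ### The two abstract cores (arbitrary topological groups / spaces) -/

section Abstract

/-- **Core of Cor. 2.3 (v), split case** (pp. 49–50: "admits a splitting … in which case the desired
equality `F̂ ∩ G = F` follows immediately").  If a continuous self-map `s` of a Hausdorff space fixes
`F` pointwise and maps `G ⊇ F` into `F`, then `closure F ∩ G = F`: the fixed set of `s` is closed, so
contains `closure F`, and `x = s x ∈ s(G) ⊆ F` for `x ∈ closure F ∩ G`.
([IUTchI] Cor 2.3(v) p.49) [claim: Mochizuki2012, status: disputed] -/
theorem closure_inter_eq_of_continuous_retraction {X : Type*} [TopologicalSpace X] [T2Space X]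
    {s : X → X} (hs : Continuous s) {F G : Set X} (hFG : F ⊆ G) (hsG : Set.MapsTo s G F)
    (hsF : ∀ f ∈ F, s f = f) : closure F ∩ G = F := by
  refine Set.Subset.antisymm ?_ fun f hf => ⟨subset_closure hf, hFG hf⟩
  rintro x ⟨hxc, hxG⟩
  have hfix : s x = x :=
    closure_minimal (fun f hf => hsF f hf) (isClosed_eq hs continuous_id) hxc
  rw [← hfix]
  exact hsG hxG

/-- **Core of Cor. 2.3 (ii)** (p. 48: "`{gᵢ·ι(fᵢ)⁻¹}` is a sequence of elements of `H` that converges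
… to `h`").  Let `p : A → B` be a continuous homomorphism of topological groups with a continuous
homomorphism `σ : B → A`, and `D ⊆ A` a dense subgroup such that `σ(p(D)) ⊆ D` and `p ∘ σ ∘ p = p` on
`D` [`σ` is a section over `p(D)`].  Then `Ker p` lies in the closure of `D ∩ Ker p`: the continuous
map `r(x) = x · σ(p x)⁻¹` is the identity on `Ker p` and carries `D` into `D ∩ Ker p`.
([IUTchI] Cor 2.3(ii) p.48) [claim: Mochizuki2012, status: disputed] -/
theorem ker_subset_closure_of_section {A B : Type*} [Group A] [TopologicalSpace A]
    [IsTopologicalGroup A] [Group B] [TopologicalSpace B] (p : A →* B) (hp : Continuous p)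
    (σ : B →* A) (hσ : Continuous σ) (D : Subgroup A) (hD : Dense (D : Set A))
    (hσD : ∀ d ∈ D, σ (p d) ∈ D) (hpσ : ∀ d ∈ D, p (σ (p d)) = p d) :
    (p.ker : Set A) ⊆ closure ((D : Set A) ∩ (p.ker : Set A)) := by
  intro x hx
  have hr : Continuous fun y : A => y * (σ (p y))⁻¹ :=
    continuous_id.mul ((hσ.comp hp).inv)
  have hfix : x * (σ (p x))⁻¹ = x := by
    rw [SetLike.mem_coe, MonoidHom.mem_ker] at hx
    rw [hx, map_one, inv_one, mul_one]
  rw [← hfix]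
  refine map_mem_closure (f := fun y : A => y * (σ (p y))⁻¹) hr (hD x) ?_
  intro d hd
  refine ⟨D.mul_mem hd (D.inv_mem (hσD d hd)), ?_⟩
  rw [SetLike.mem_coe, MonoidHom.mem_ker, map_mul, map_inv, hpσ d hd, mul_inv_cancel]

/-- Under the hypotheses of `ker_subset_closure_of_section` and with `B` a `T₁` group, the kernel of
`p` IS the closure of `D ∩ Ker p`. ([IUTchI] Cor 2.3(ii) p.48) [claim: Mochizuki2012, status: disputed] -/
theorem closure_inter_ker_eq_of_section {A B : Type*} [Group A] [TopologicalSpace A]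
    [IsTopologicalGroup A] [Group B] [TopologicalSpace B] [T1Space B] (p : A →* B) (hp : Continuous p)
    (σ : B →* A) (hσ : Continuous σ) (D : Subgroup A) (hD : Dense (D : Set A))
    (hσD : ∀ d ∈ D, σ (p d) ∈ D) (hpσ : ∀ d ∈ D, p (σ (p d)) = p d) :
    closure ((D : Set A) ∩ (p.ker : Set A)) = (p.ker : Set A) := by
  have hclosed : IsClosed (p.ker : Set A) := by
    have : (p.ker : Set A) = p ⁻¹' {1} := by ext; simp
    rw [this]
    exact isClosed_singleton.preimage hp
  exact Set.Subset.antisymm (closure_minimal Set.inter_subset_right hclosed)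
    (ker_subset_closure_of_section p hp σ hσ D hD hσD hpσ)

end Abstract

/-! ### Profinite completions: functoriality (the universal arrow) -/

section Completion

variable {G : Type u} [Group G] {Q : Type u} [Group Q]

/-- A homomorphism `π : G → Q` induces a continuous homomorphism `π̂ : Ĝ → Q̂` of profinite
completions with `π̂ ∘ η_G = η_Q ∘ π` — Mathlib's universal arrow `ProfiniteCompletion.lift` applied
to `η_Q ∘ π` ("induces a surjection `Ĝ ↠ F̂` between the respective … completions", p. 48).
([IUTchI] Cor 2.3(ii) p.48) [claim: Mochizuki2012, status: disputed] -/
theorem exists_completion_map (π : G →* Q) :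
    ∃ p : profiniteCompletion G →* profiniteCompletion Q,
      Continuous p ∧ ∀ g : G, p (toCompletion G g) = toCompletion Q (π g) := by
  let f : GrpCat.of G ⟶ GrpCat.of (profiniteCompletion Q) :=
    GrpCat.ofHom ((toCompletion Q).comp π)
  let ph : profiniteCompletion G ⟶ profiniteCompletion Q :=
    ProfiniteCompletion.lift (G := GrpCat.of G) (P := profiniteCompletion Q) f
  refine ⟨ph.hom.toMonoidHom, ph.hom.continuous_toFun, fun g => ?_⟩
  exact ConcreteCategory.congr_hom (ProfiniteCompletion.lift_eta f) g

/-- The induced map is determined on the dense image of `G`: two continuous homomorphisms out of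
`Ĝ` that agree on `η_G(G)` are equal. ([IUTchI] Cor 2.3(ii) p.48) [claim: Mochizuki2012, status: disputed] -/
theorem completion_map_unique {P : Type*} [Group P] [TopologicalSpace P] [T2Space P]
    {p₁ p₂ : profiniteCompletion G →* P} (h₁ : Continuous p₁) (h₂ : Continuous p₂)
    (h : ∀ g : G, p₁ (toCompletion G g) = p₂ (toCompletion G g)) : p₁ = p₂ := by
  have hdense : DenseRange (toCompletion G) := denseRange (GrpCat.of G)
  exact MonoidHom.ext fun x => congrFun (hdense.equalizer h₁ h₂ (funext h)) x

/-! ### Cor. 2.3 (ii): density of kernels -/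

/-- **The elementary observation of the proof of Cor. 2.3 (ii)** (p. 48), for profinite completions:
if `π : G → Q` has a section `s` (`π ∘ s = id`; "which exists since `F` is free"), then for the
induced `π̂ : Ĝ → Q̂` the kernel `Ker π̂` is the CLOSURE of the image of `Ker π` — "`H = Ker(G ↠ F)`
is dense in `Ĥ = Ker(Ĝ ↠ F̂)`".  [No residual finiteness of `G` or `Q` is needed: an element
`η_G(g)` of `Ker π̂` has `π g ∈ Ker η_Q`, and `η_G(g) = η_G(g·s(π g)⁻¹) · ŝ(η_Q(π g)) = η_G(g·s(π g)⁻¹)`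
with `g·s(π g)⁻¹ ∈ Ker π`.] ([IUTchI] Cor 2.3(ii) p.48) [claim: Mochizuki2012, status: disputed] -/
theorem closure_image_ker_eq_ker_of_section (π : G →* Q) (s : Q →* G) (hs : ∀ q, π (s q) = q)
    {p : profiniteCompletion G →* profiniteCompletion Q} (hp : Continuous p)
    (hpη : ∀ g : G, p (toCompletion G g) = toCompletion Q (π g)) :
    closure (toCompletion G '' (π.ker : Set G)) = (p.ker : Set (profiniteCompletion G)) := by
  obtain ⟨σ, hσ, hση⟩ := exists_completion_map s
  have hdense : Dense ((toCompletion G).range : Set (profiniteCompletion G)) := by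
    rw [MonoidHom.coe_range]
    exact denseRange (GrpCat.of G)
  -- the closure of `η(Ker π)` lies in the (closed) kernel
  have hclosed : IsClosed (p.ker : Set (profiniteCompletion G)) := by
    have : (p.ker : Set (profiniteCompletion G)) = p ⁻¹' {1} := by ext; simp
    rw [this]
    exact isClosed_singleton.preimage hp
  refine Set.Subset.antisymm (closure_minimal ?_ hclosed) ?_
  · rintro _ ⟨g, hg, rfl⟩
    rw [SetLike.mem_coe, MonoidHom.mem_ker] at hg ⊢
    rw [hpη, hg, map_one]
  -- conversely, `Ker π̂ ⊆ closure(η(G) ∩ Ker π̂)` by the abstract core, and `η(G) ∩ Ker π̂ = η(Ker π)`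
  have hcore := ker_subset_closure_of_section p hp σ hσ (toCompletion G).range hdense
    (by
      rintro _ ⟨g, rfl⟩
      exact ⟨s (π g), by rw [hpη, hση]⟩)
    (by
      rintro _ ⟨g, rfl⟩
      rw [hpη, hση, hpη, hs])
  refine hcore.trans (closure_mono ?_)
  rintro _ ⟨⟨g, rfl⟩, hg⟩
  rw [SetLike.mem_coe, MonoidHom.mem_ker, hpη] at hg
  refine ⟨g * (s (π g))⁻¹, ?_, ?_⟩
  · rw [SetLike.mem_coe, MonoidHom.mem_ker, map_mul, map_inv, hs, mul_inv_cancel]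
  · rw [map_mul, map_inv, ← hση, hg, map_one, inv_one, mul_one]

/-- **Cor. 2.3 (ii), the printed case** (p. 48): a SURJECTION `π : G ↠ F(β)` onto a free group has a
section ("which exists since `F` is free"), so `Ker π̂` is the closure of the image of `Ker π` in `Ĝ`.
([IUTchI] Cor 2.3(ii) p.48) [claim: Mochizuki2012, status: disputed] -/
theorem closure_image_ker_eq_ker_of_surjective_freeGroup {β : Type u} (π : G →* FreeGroup β)
    (hπ : Function.Surjective π) {p : profiniteCompletion G →* profiniteCompletion (FreeGroup β)}
    (hp : Continuous p) (hpη : ∀ g : G, p (toCompletion G g) = toCompletion (FreeGroup β) (π g)) :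
    closure (toCompletion G '' (π.ker : Set G)) = (p.ker : Set (profiniteCompletion G)) := by
  classical
  -- a section: send each free generator to a chosen preimage
  let s : FreeGroup β →* G := FreeGroup.lift fun b => Classical.choose (hπ (FreeGroup.of b))
  have hs : ∀ q, π (s q) = q := by
    intro q
    have hcomp : π.comp s = MonoidHom.id (FreeGroup β) := by
      ext b
      simp only [MonoidHom.coe_comp, Function.comp_apply, MonoidHom.id_apply, s,
        FreeGroup.lift_apply_of]
      exact Classical.choose_spec (hπ (FreeGroup.of b))
    exact DFunLike.congr_fun hcomp q
  exact closure_image_ker_eq_ker_of_section π s hs hp hpη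

/-! ### Cor. 2.3 (v): `F̂ ∩ G = F` -/

/-- **Cor. 2.3 (v), split case, for any group** (pp. 49–50: "the inclusion `F ⊆ G` admits a splitting
`G ↠ F` …, in which case the desired equality `F̂ ∩ G = F` follows immediately"): if `F = r(G)` for an
endomorphism `r` of `G` fixing `F` pointwise (a retraction of `G` onto `F`), then inside `Ĝ` the
closure of `η(F)` meets `η(G)` exactly in `η(F)`. ([IUTchI] Cor 2.3(v) p.50) [claim: Mochizuki2012, status: disputed] -/
theorem range_inter_closure_image_of_retract (r : G →* G) (F : Subgroup G)
    (hrF : ∀ f ∈ F, r f = f) (hr : ∀ g, r g ∈ F) :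
    Set.range (toCompletion G) ∩ closure (toCompletion G '' (F : Set G)) =
      toCompletion G '' (F : Set G) := by
  obtain ⟨ρ, hρ, hρη⟩ := exists_completion_map r
  rw [Set.inter_comm]
  refine closure_inter_eq_of_continuous_retraction hρ ?_ ?_ ?_
  · rintro _ ⟨f, -, rfl⟩
    exact ⟨f, rfl⟩
  · rintro _ ⟨g, rfl⟩
    exact ⟨r g, hr g, (hρη g).symm⟩
  · rintro _ ⟨f, hf, rfl⟩
    rw [hρη, hrF f hf]

/-- Split case, pointwise, when `η_G` is injective (`G` residually finite — "we think of `G` and `F`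
as subgroups of `Ĝ` and `F̂`", p. 48): `η(g) ∈ closure(η(F)) ↔ g ∈ F` for a retract `F = r(G)`.
([IUTchI] Cor 2.3(v) p.50) [claim: Mochizuki2012, status: disputed] -/
theorem toCompletion_mem_closure_image_iff_of_retract (r : G →* G) (F : Subgroup G)
    (hrF : ∀ f ∈ F, r f = f) (hr : ∀ g, r g ∈ F) (hη : Function.Injective (toCompletion G))
    (g : G) : toCompletion G g ∈ closure (toCompletion G '' (F : Set G)) ↔ g ∈ F := by
  refine ⟨fun hg => ?_, fun hg => subset_closure ⟨g, hg, rfl⟩⟩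
  have hmem : toCompletion G g ∈
      Set.range (toCompletion G) ∩ closure (toCompletion G '' (F : Set G)) := ⟨⟨g, rfl⟩, hg⟩
  rw [range_inter_closure_image_of_retract r F hrF hr] at hmem
  obtain ⟨f, hf, hfg⟩ := hmem
  rwa [← hη hfg]

/-- **Cor. 2.3 (v) for free groups, finitely generated case** (p. 49: "for any finitely generated
subgroup `F ⊆ G`, … `F̂ ∩ G = F`"), pointwise: for `H ≤ F(α)` finitely generated, `η(f)` lies in the
closure of `η(H)` in `F(α)^` iff `f ∈ H`.  From separability of finitely generated subgroups of free
groups (M. Hall; tree `exists_normal_finiteIndex_not_mem_sup`) and the component description of the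
closure (`val_mem_map_of_mem_closure`). ([IUTchI] Cor 2.3(v) p.49) [claim: Mochizuki2012, status: disputed] -/
theorem toCompletion_mem_closure_image_iff_of_fg {α : Type u} (H : Subgroup (FreeGroup α))
    (hH : H.FG) (f : FreeGroup α) :
    toCompletion (FreeGroup α) f ∈ closure (toCompletion (FreeGroup α) '' (H : Set (FreeGroup α))) ↔
      f ∈ H := by
  refine ⟨fun hf => ?_, fun hf => subset_closure ⟨f, hf, rfl⟩⟩
  by_contra hfH
  obtain ⟨P, hPn, hPf, hnot⟩ := exists_normal_finiteIndex_not_mem_sup H hH hfH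
  let N : FiniteIndexNormalSubgroup (FreeGroup α) := { toSubgroup := P }
  have hval := val_mem_map_of_mem_closure hf N
  obtain ⟨h, hh, hhf⟩ := Subgroup.mem_map.mp hval
  change (QuotientGroup.mk h : FreeGroup α ⧸ P) = QuotientGroup.mk f at hhf
  rw [QuotientGroup.eq] at hhf
  apply hnot
  have hf' : f = h * (h⁻¹ * f) := by group
  rw [hf']
  exact (H ⊔ P).mul_mem (Subgroup.mem_sup_left hh) (Subgroup.mem_sup_right hhf)

/-- **Cor. 2.3 (v) for free groups, finitely generated case**, as the printed equality
"`F̂ ∩ G = F`" inside `Ĝ`: `η(F(α)) ∩ closure(η(H)) = η(H)` for `H ≤ F(α)` finitely generated.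
([IUTchI] Cor 2.3(v) p.49) [claim: Mochizuki2012, status: disputed] -/
theorem range_inter_closure_image_of_fg {α : Type u} (H : Subgroup (FreeGroup α)) (hH : H.FG) :
    Set.range (toCompletion (FreeGroup α)) ∩
        closure (toCompletion (FreeGroup α) '' (H : Set (FreeGroup α))) =
      toCompletion (FreeGroup α) '' (H : Set (FreeGroup α)) := by
  ext x
  constructor
  · rintro ⟨⟨f, rfl⟩, hx⟩
    exact ⟨f, (toCompletion_mem_closure_image_iff_of_fg H hH f).mp hx, rfl⟩
  · rintro ⟨f, hf, rfl⟩
    exact ⟨⟨f, rfl⟩, subset_closure ⟨f, hf, rfl⟩⟩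

end Completion

end Literature.IUT.HodgeTheaters.ProfiniteCompletion

/-! ### Cor. 2.3 (ii), concluded: closures of inverse images ("the closure of `Δ_{X,ℍ}` is `Δ̂_{X,ℍ}`") -/

namespace Literature.IUT.HodgeTheaters.ProfiniteCompletion

open CategoryTheory ProfiniteGrp ProfiniteGrp.ProfiniteCompletion Topology

universe u

/-- **Cor. 2.3 (ii), abstract form of the whole step** (p. 48: "(ii) follows immediately from the
definitions … together with the [kernel-density] observation").  Let `p : A → B` be a continuous
homomorphism from a COMPACT group to a Hausdorff group, `D ≤ A` a subgroup whose kernel part is dense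
in `Ker p` [`Ker p ⊆ closure(D ∩ Ker p)`, cf. `ker_subset_closure_of_section`], and `S ≤ B` a subgroup
with `S ⊆ p(D)`.  Then the closure of `D ∩ p⁻¹(S)` is the FULL inverse image `p⁻¹(closure S)`: the
closure is a closed subgroup containing `Ker p` whose (compact, hence closed) image contains `S`.
[In the text: `A = Δ̂_X ↠ B = Π̂_𝔾`, `D = Δ^tp_X`, `S = Π^tp_ℍ`, so `D ∩ p⁻¹(S) = Δ^tp_{X,ℍ}` and
`p⁻¹(closure S) = Δ̂_X ×_{Π̂_𝔾} Π̂_ℍ = Δ̂_{X,ℍ}`.] ([IUTchI] Cor 2.3(ii) p.48) [claim: Mochizuki2012, status: disputed] -/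
theorem closure_inter_preimage_eq_preimage_closure {A B : Type*} [Group A] [TopologicalSpace A]
    [IsTopologicalGroup A] [CompactSpace A] [Group B] [TopologicalSpace B] [IsTopologicalGroup B]
    [T2Space B] (p : A →* B) (hp : Continuous p) (D : Subgroup A)
    (hker : (p.ker : Set A) ⊆ closure ((D : Set A) ∩ (p.ker : Set A))) (S : Subgroup B)
    (hS : (S : Set B) ⊆ p '' D) :
    closure ((D : Set A) ∩ p ⁻¹' S) = p ⁻¹' closure (S : Set B) := by
  refine Set.Subset.antisymm
    (closure_minimal (fun x hx => subset_closure hx.2) (isClosed_closure.preimage hp)) ?_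
  -- `C` := the closure of the subgroup `D ∩ p⁻¹(S)`
  let C : Subgroup A := (D ⊓ S.comap p).topologicalClosure
  have hCcoe : (C : Set A) = closure ((D : Set A) ∩ p ⁻¹' S) := by
    rw [Subgroup.topologicalClosure_coe, Subgroup.coe_inf, Subgroup.coe_comap]
  -- `Ker p ⊆ C`
  have hkerC : (p.ker : Set A) ⊆ C := by
    rw [hCcoe]
    refine hker.trans (closure_mono ?_)
    rintro y ⟨hyD, hyk⟩
    refine ⟨hyD, ?_⟩
    rw [SetLike.mem_coe, MonoidHom.mem_ker] at hyk
    rw [Set.mem_preimage, hyk]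
    exact S.one_mem
  -- `p(C)` is closed and contains `S`, hence `closure S`
  have hpC : IsClosed (p '' (C : Set A)) :=
    ((Subgroup.isClosed_topologicalClosure (D ⊓ S.comap p)).isCompact.image hp).isClosed
  have hSC : (S : Set B) ⊆ p '' (C : Set A) := by
    intro b hb
    obtain ⟨d, hd, rfl⟩ := hS hb
    refine ⟨d, ?_, rfl⟩
    rw [hCcoe]
    exact subset_closure ⟨hd, hb⟩
  intro x hx
  obtain ⟨c, hc, hcx⟩ := (closure_minimal hSC hpC) hx
  have hk : c⁻¹ * x ∈ p.ker := by
    rw [MonoidHom.mem_ker, map_mul, map_inv, hcx, inv_mul_cancel]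
  rw [← hCcoe]
  have hx' : x = c * (c⁻¹ * x) := by group
  rw [hx']
  exact C.mul_mem hc (hkerC hk)

section Completion

variable {G : Type u} [Group G] {Q : Type u} [Group Q]

/-- **Cor. 2.3 (ii) for profinite completions, concluded**: if `π : G → Q` has a section `s` and
`π̂ : Ĝ → Q̂` is the induced map, then for every subgroup `S ≤ Q` the closure in `Ĝ` of the image of
`π⁻¹(S)` is the FULL inverse image `π̂⁻¹(closure of the image of S)` — "the closure of
`Δ^tp_{X,ℍ} = Δ^tp_X ×_{Π^tp_𝔾} Π^tp_ℍ` in `Δ̂_X` is `Δ̂_{X,ℍ} = Δ̂_X ×_{Π̂_𝔾} Π̂_ℍ`".  (No residual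
finiteness needed: with the section, `η_G(G) ∩ π̂⁻¹(η_Q(S)) = η_G(π⁻¹(S))`.)
([IUTchI] Cor 2.3(ii) p.48) [claim: Mochizuki2012, status: disputed] -/
theorem closure_image_comap_eq_preimage_closure_of_section (π : G →* Q) (s : Q →* G)
    (hs : ∀ q, π (s q) = q) {p : profiniteCompletion G →* profiniteCompletion Q} (hp : Continuous p)
    (hpη : ∀ g : G, p (toCompletion G g) = toCompletion Q (π g)) (S : Subgroup Q) :
    closure (toCompletion G '' (S.comap π : Set G)) =
      p ⁻¹' closure (toCompletion Q '' (S : Set Q)) := by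
  obtain ⟨σ, hσ, hση⟩ := exists_completion_map s
  have hdense : Dense ((toCompletion G).range : Set (profiniteCompletion G)) := by
    rw [MonoidHom.coe_range]
    exact denseRange (GrpCat.of G)
  have hker := ker_subset_closure_of_section p hp σ hσ (toCompletion G).range hdense
    (by
      rintro _ ⟨g, rfl⟩
      exact ⟨s (π g), by rw [hpη, hση]⟩)
    (by
      rintro _ ⟨g, rfl⟩
      rw [hpη, hση, hpη, hs])
  have key := closure_inter_preimage_eq_preimage_closure p hp (toCompletion G).range hker
    (S.map (toCompletion Q)) (by
      rintro _ ⟨q, hq, rfl⟩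
      exact ⟨toCompletion G (s q), ⟨s q, rfl⟩, by rw [hpη, hs]⟩)
  rw [Subgroup.coe_map] at key
  rw [← key]
  congr 1
  apply Set.Subset.antisymm
  · rintro _ ⟨g, hg, rfl⟩
    refine ⟨⟨g, rfl⟩, ?_⟩
    rw [Set.mem_preimage, hpη]
    exact ⟨π g, hg, rfl⟩
  · rintro _ ⟨⟨g, rfl⟩, hg⟩
    rw [Set.mem_preimage, hpη] at hg
    obtain ⟨q, hq, hqg⟩ := hg
    -- `η_Q q = η_Q (π g)` with `q ∈ S`: then `g · (s (q⁻¹ π g))⁻¹ ∈ π⁻¹(S)` has the same image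
    refine ⟨g * (s (q⁻¹ * π g))⁻¹, ?_, ?_⟩
    · rw [SetLike.mem_coe, Subgroup.mem_comap, map_mul, map_inv, hs, mul_inv_rev, inv_inv,
        mul_inv_cancel_left]
      exact hq
    · rw [map_mul, map_inv, ← hση, map_mul, map_inv, ← hqg, inv_mul_cancel, map_one, inv_one,
        mul_one]

end Completion

end Literature.IUT.HodgeTheaters.ProfiniteCompletion
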